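import Literature.Barriers.RiemannHypothesis.BeurlingCounterexamples
import Literature.NumberTheory.BeurlingPrimes.DMVApproximation
import Mathlib.MeasureTheory.Measure.Stieltjes
import Mathlib.MeasureTheory.Integral.Bochner.Basic
import Mathlib.MeasureTheory.Integral.IntervalIntegral.Basic
import HarnessLib

/-!
# Well-behaved Beurling number systems: the architecture of Broucke–Debruyne–Révész 2023, Theorem 1.1

Topic `Literature/NumberTheory/BeurlingPrimes`. This file vendors, as NAMED FACTS with the sources' own
numbering, the published results from which Broucke–Debruyne–Révész (BDR 2023) assemble

> **Theorem 1.1.** For any `α ∈ [0,1)` and `β ∈ [1/2, 1)` there exists an `[α, β]`-system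

(the tree's `Literature.Barriers.RiemannHypothesis.BrouckeDebruyneRevesz2023_thm11`, stated over the
discrete Beurling systems `BeurlingPrimes` / `IsSystem` of the barrier file `BeurlingCounterexamples`), and
PROVES the top-level case split `BrouckeDebruyneRevesz2023_thm11_of_cases`. The leaves are deep
(probabilistic prime approximation, Perron inversion for Beurling zeta functions, Hilberdink's uncertainty
principle); they are recorded here so that they can be discharged bottom-up, one file each.

## The printed proof (BDR 2023, §1 and §§3–4)

"The construction of `[α,β]`-systems will be done in two stages. First, a generalized number system in the
extended sense will be constructed which satisfies the requirements. … Next, we show that this number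
system in the extended sense can be suitably approximated by an actual discrete system `(𝒫, 𝒩)`. The key
technical tool for this is the following theorem" — the random prime approximation of Broucke–Vindas
(BDR Thm 1.2 = BV 2024 Thm 1.2, `BrouckeVindas2024_thm12`). "The two cases `1/2 ≤ β ≤ α` and `α < β`
require different approaches. In the first case, we prescribe certain zeros and poles for the Beurling zeta
function [§3, Theorem 3.2 `BrouckeDebruyneRevesz2023_thm32`, Corollary 3.3 `…_cor33`; and Corollary 3.4
`…_cor34` for `α < 1/2 = β`, whose `Ω`-part is Hilberdink's `max{α, β} ≥ 1/2`
(`Literature.Barriers.RiemannHypothesis.Hilberdink2005_thm1`) and whose case `α = 0` is the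
`[0, 1/2]`-system of BV 2024, Thm 3.1 `BrouckeVindas2024_thm31`], while in the second case, we prescribe a
certain kind of extreme growth [§4, `BrouckeDebruyneRevesz2023_sec4`]."

Dependency graph (what each fact rests on in print):
* `BrouckeVindas2024_thm12` — probabilistic method (BV 2024, §2).
* `BrouckeVindas2024_thm31` ← `thm12` with `F = li`, Perron inversion on `σ_x = 1/2 + (log x)^{-1/3}`,
  Hilberdink–Neamah for the `Ω`-part (BV 2024, §3).
* `BrouckeDebruyneRevesz2023_thm32` ← Lemma 3.1 (monotone template `li(x) + Σ li(x^ω) − Σ li(x^ρ) + M li(x^δ)`),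
  `thm12`, Mellin–Stieltjes calculus, Perron inversion with contour shift (BDR §3).
* `…_cor33` ← `thm32` with `ℛ = {α}`, `𝒮 = {β}` (`ℛ = ∅` if `α = β`); for `β = 1/2` the `Ω`-part from the pole
  of `ζ_𝒫` at `1/2` via `ζ_𝒫(s) − as/(s−1) = s ∫₁^∞ x^{−s−1}(N_𝒫(x) − ax) dx` (BDR, proof of Cor. 3.3).
* `…_cor34` ← `thm32` with `ℛ = {α}`, `𝒮 = ∅`, `δ < α` (`0 < α < 1/2`), `thm31` (`α = 0`), and
  `Hilberdink2005_thm1` for "`N_𝒫(x) − ax ≪ x^{1/2−ε}` cannot hold" (BDR, proof of Cor. 3.4).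
* `…_sec4` ← template `Π_C = Li(x) − Li(x^α) + Σ_l R_l` with extreme growth of `ζ_C` left of `Re s = β`,
  `thm12` with `F = π_C`, Perron inversion on `Re s = β` (BDR §4).
* `thm11` ← `cor33` (`β ≤ α`), `cor34` (`α < β = 1/2`), `sec4` (`α < β`, `β > 1/2`): PROVED below.

## References

* [BrouckeDebruyneRevesz2023] F. Broucke, G. Debruyne, Sz. Gy. Révész, *Some examples of well-behaved
  Beurling number systems*, arXiv:2309.01567, Trans. Amer. Math. Soc. (2024) (read, arXiv version: §1
  with Theorems 1.1–1.3 and the definition of `[α,β]`-systems, §2, §3 with Lemma 3.1, Theorem 3.2,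
  Corollaries 3.3–3.4, Remark 3.5, §4 with Remark 4.1).
* [BrouckeVindas2024] F. Broucke, J. Vindas, *A new generalized prime random approximation procedure and
  some of its applications*, Math. Z. 307 (2024), arXiv:2102.08478 (read: §1 Theorems 1.1–1.2, §3
  Theorem 3.1 with its proof, Remark 3.2).
* [Hilberdink2005] T. W. Hilberdink, *Well-behaved Beurling primes and integers*, J. Number Theory 112
  (2005) 332–344, Theorem 1 (vendored in the barrier file as `Hilberdink2005_thm1`).

## Design notes

* `Li x = ∫₁ˣ (1 − u⁻¹)/log u du` is the normalisation of BV/BDR ("defined here as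
  `Li(x) := ∫_1^x (1−u^{-1})/log u du`", BDR §1; `= Σ_{n≥1} (log x)^n/(n·n!)`, BDR (2.1)); it differs from the
  tree's Eulerian `Literature.NumberTheory.LFunctions.offsetLogIntegral = ∫₂ˣ dt/log t` by
  `−log log x + O(1)`, so it is a separate definition. `riemannPrimeCount P x = Π_𝒫(x) = Σ_k π_𝒫(x^{1/k})/k`
  is the `tsum` of the finitely supported family `(j,k) ↦ 1/(k+1) · [λ_j^{k+1} ≤ x]`, exactly as
  `chebyshevPsi` in the barrier file. `stieltjesExpSum F x t = ∫_{[1,x]} u^{−it} dF(u)` is the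
  Lebesgue–Stieltjes integral against Mathlib's `StieltjesFunction.measure`; for the `F` of Theorem 1.2
  (`F(1) = 0`, `F ≥ 0`, non-decreasing) `dF` has no mass on `(−∞, 1]`, so `[1,x]` and `(1,x]` agree, and the
  discrete side `BeurlingPrimes.primeSum x t = Σ_{λ_j ≤ x} λ_j^{−it}` (tree, `DMVApproximation`) also counts
  `λ_j = x`.
* `O`-statements are vendored as global bounds on the printed ranges (`x ≥ 1`, `x ≥ 2`; `x ≥ 3` for an
  `O(log log x)` so that the gauge is positive), which is equivalent to the asymptotic reading because all
  counting functions involved are locally bounded; "`f = Ω(g)`" is BDR's "`∃ ε > 0` and `x_n → ∞` with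
  `|f(x_n)| ≥ ε g(x_n)`" (§1, notation), written with `∃ᶠ x in atTop`.
* Theorem 3.2 is vendored in the special case of REAL zeros and poles of multiplicity one
  (`ℛ, 𝒮 ⊂ (0,1)` finite and disjoint) — all that Corollaries 3.3–3.4 use; then `x^ω Σ_j b_{ω,j}(log x)^j`
  is `b_ω x^ω` with `b_ω = b_{ω,0} ≠ 0` real (`b_{ω̄,j} = \overline{b_{ω,j}}`). Its last clause records the
  factorisation `ζ_𝒫(s) = E_M(s) e^{Z(s)}` "of the system from the proof" with `Z` holomorphic on `Re s > 0` and
  the bound (3.4), from which the meromorphic continuation, zeros `= ℛ` and poles `= 𝒮 ∪ {1} ∪ {δ}^M` follow.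
* NOT here: the clauses of BV Thm 3.1 on the Möbius sum function `M_𝒫` (not needed); complex or multiple
  zeros/poles in Thm 3.2; BDR Thm 1.3 / Lemma 5.1 (the conditional `β < 1/2` systems, vendored as
  `BrouckeDebruyneRevesz2023_thm13` in the barrier file); the `[α,1]`- and `[1,β]`-systems of Remarks 3.5, 4.1.
-/

noncomputable section

open Complex Filter MeasureTheory Set
open scoped Topology

namespace Literature.NumberTheory.BeurlingPrimes

open Literature.Barriers.RiemannHypothesis

/-! ## Definitions -/

/-- The logarithmic integral in the normalisation of Broucke–Vindas and Broucke–Debruyne–Révész: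
`Li(x) = ∫₁ˣ (1 − u⁻¹)/log u du` (`= Σ_{n ≥ 1} (log x)^n/(n · n!)`; the template whose zeta function is
`s/(s − 1)` and whose integers are `N(x) = x`). [cite: BrouckeDebruyneRevesz2023, §1 and (2.1)] -/
def Li (x : ℝ) : ℝ :=
  ∫ u in (1 : ℝ)..x, (1 - u⁻¹) / Real.log u

/-- `Li(1) = 0`. [cite: BrouckeDebruyneRevesz2023, (2.1)] -/
@[simp] theorem Li_one : Li 1 = 0 := by
  simp [Li]

/-- Riemann's prime-counting function of a Beurling system,
`Π_𝒫(x) = Σ_{k ≥ 1} π_𝒫(x^{1/k})/k = Σ_{λ_j^k ≤ x} 1/k` (BDR §1: "`Π_𝒫(x) := Σ_{k=1}^∞ (1/k) π_𝒫(x^{1/k})`"),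
as the `tsum` of the finitely supported family `(j, k) ↦ 1/(k+1) · [λ_j^{k+1} ≤ x]` (dot-notation extension of
the barrier file's `BeurlingPrimes`, declared with its absolute name). [cite: BrouckeDebruyneRevesz2023, §1] -/
def _root_.Literature.Barriers.RiemannHypothesis.BeurlingPrimes.riemannPrimeCount (P : BeurlingPrimes)
    (x : ℝ) : ℝ :=
  ∑' jk : ℕ × ℕ, if P.prime jk.1 ^ (jk.2 + 1) ≤ x then 1 / ((jk.2 : ℝ) + 1) else 0

/-- `Π_𝒫(x) = 0` for `x < 1` (every prime power exceeds `1`). [cite: BrouckeDebruyneRevesz2023, §1] -/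
theorem _root_.Literature.Barriers.RiemannHypothesis.BeurlingPrimes.riemannPrimeCount_eq_zero_of_lt_one
    (P : BeurlingPrimes) {x : ℝ} (hx : x < 1) : P.riemannPrimeCount x = 0 := by
  unfold BeurlingPrimes.riemannPrimeCount
  have h : ∀ jk : ℕ × ℕ, ¬ P.prime jk.1 ^ (jk.2 + 1) ≤ x := fun jk hle ↦ by
    have h1 : 1 ≤ P.prime jk.1 ^ (jk.2 + 1) := one_le_pow₀ (P.one_lt_prime jk.1).le
    linarith
  simp [h]

/-- The Stieltjes exponential integral `∫_{[1,x]} u^{−it} dF(u)` of a non-decreasing right-continuous `F`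
(BV 2024, Thm 1.2: "`∫_1^x u^{−it} dF(u)`"), against Mathlib's Lebesgue–Stieltjes measure `F.measure`.
[cite: BrouckeVindas2024, Theorem 1.2] -/
def stieltjesExpSum (F : StieltjesFunction ℝ) (x t : ℝ) : ℂ :=
  ∫ u in Icc 1 x, ((u : ℂ) ^ (-(t * I))) ∂F.measure

/-! ## The random prime approximation (Broucke–Vindas 2024, Theorem 1.2 = BDR 2023, Theorem 1.2) -/

/-- **Broucke–Vindas 2024, Theorem 1.2** (= BDR 2023, Theorem 1.2; the discretisation theorem). "Let `F` be a
non-decreasing right-continuous function tending to `∞`, with `F(1) = 0` and satisfying the Chebyshev upper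
bound `F(x) ≪ x/log x`. Then there exists a set of generalized primes `𝒫 = {p_j}_{j=0}^∞` such that
`|π_𝒫(x) − F(x)| ≤ 2` and such that for any `t` and any `x ≥ 1`
`|Σ_{p_j ≤ x} p_j^{−it} − ∫_1^x u^{−it} dF(u)| ≪ √x + √(x log(|t|+1)/log(x+1))`. If in addition `F` is
continuous, the sequence `𝒫` can be chosen to be (strictly) increasing and such that `|π_𝒫(x) − F(x)| ≤ 1`."
(`F` non-negative, as in BV's abstract; a "set of generalized primes" is an unbounded non-decreasing sequence
with `p_0 > 1`, BV §1, i.e. a `BeurlingPrimes`.) [cite: BrouckeVindas2024, Theorem 1.2] -/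
def BrouckeVindas2024_thm12 : Prop :=
  ∀ F : StieltjesFunction ℝ, F 1 = 0 → (∀ x : ℝ, 0 ≤ F x) → Tendsto (fun x : ℝ ↦ F x) atTop atTop →
    (∃ C : ℝ, ∀ x : ℝ, 2 ≤ x → F x ≤ C * x / Real.log x) →
    (∃ P : BeurlingPrimes,
      (∀ x : ℝ, |(P.primeCount x : ℝ) - F x| ≤ 2) ∧
      ∃ C : ℝ, ∀ t x : ℝ, 1 ≤ x →
        ‖P.primeSum x t - stieltjesExpSum F x t‖
          ≤ C * (Real.sqrt x + Real.sqrt (x * Real.log (|t| + 1) / Real.log (x + 1)))) ∧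
    (Continuous (fun x : ℝ ↦ F x) → ∃ P : BeurlingPrimes, StrictMono P.prime ∧
      (∀ x : ℝ, |(P.primeCount x : ℝ) - F x| ≤ 1) ∧
      ∃ C : ℝ, ∀ t x : ℝ, 1 ≤ x →
        ‖P.primeSum x t - stieltjesExpSum F x t‖
          ≤ C * (Real.sqrt x + Real.sqrt (x * Real.log (|t| + 1) / Real.log (x + 1))))

/-- **Broucke–Vindas 2024, Theorem 3.1** (the `[0, 1/2]`-system; BDR §1: "In that paper, the existence of
`[0,1/2]`-systems was shown", and BDR Cor. 3.4 for `α = 0`). "There is a discrete Beurling generalized prime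
system `𝒫` such that `Π_𝒫(x) = Li(x) + O(log log x)`, `N_𝒫(x) = x + O(x^{1/2} exp(c (log x)^{2/3}))` … for
some `c > 0`, and `N_𝒫(x) = x + Ω_ε(x^{1/2−ε})` … for any `ε > 0`." The clauses on the Möbius sum function
`M_𝒫` are omitted. [cite: BrouckeVindas2024, Theorem 3.1] -/
def BrouckeVindas2024_thm31 : Prop :=
  ∃ P : BeurlingPrimes,
    (∃ C : ℝ, ∀ x : ℝ, 3 ≤ x → |P.riemannPrimeCount x - Li x| ≤ C * Real.log (Real.log x)) ∧
    (∃ c C : ℝ, 0 < c ∧ ∀ x : ℝ, 2 ≤ x →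
      |(P.intCount x : ℝ) - x| ≤ C * (x ^ (1 / 2 : ℝ) * Real.exp (c * Real.log x ^ (2 / 3 : ℝ)))) ∧
    (∀ ε : ℝ, 0 < ε → ∃ c : ℝ, 0 < c ∧
      ∃ᶠ x : ℝ in atTop, c * x ^ (1 / 2 - ε) ≤ |(P.intCount x : ℝ) - x|)

/-! ## Prescribed zeros and poles (BDR 2023, Theorem 3.2) and the three cases of Theorem 1.1 -/

/-- **Broucke–Debruyne–Révész 2023, Theorem 3.2** (real zeros and poles of multiplicity one). "Let `ℛ`, `𝒮`
be two finite, symmetric, disjoint multisets and `Re ω, Re ρ ∈ (0,1)` for all `ω ∈ 𝒮`, `ρ ∈ ℛ`. Then for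
each `0 < δ < 1/2` there exists a Beurling number system `(𝒫, 𝒩)` with the following properties:
• `ψ_𝒫(x) = x + Σ_{ω∈𝒮} x^ω/ω − Σ_{ρ∈ℛ} x^ρ/ρ + O(x^δ)`, `x ≥ 1`;
• `N_𝒫(x) = ax + Σ_{ω∈S, Re ω>1/2} x^ω Σ_{j<m(ω)} b_{ω,j}(log x)^j + O{x^{1/2} exp(c (log x)^{2/3})}`, `x ≥ 2`,
for certain constants `a > 0`, `b_{ω,j} ∈ ℂ` and `c > 0`, with `b_{ω̄,j} = \overline{b_{ω,j}}` and
`b_{ω,m(ω)−1} ≠ 0`. We note that the associated zeta function of the system from the proof is given by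
`ζ_𝒫(s) = E(s)e^{Z(s)}`, where `E(s) = E_M(s) := s/(s−1) Π_{ω∈𝒮} s/(s−ω) Π_{ρ∈ℛ} (s−ρ)/s (s/(s−δ))^M` for a
sufficiently large integer `M`, and `Z(s)` is a function holomorphic on `Re s > 0` which satisfies
`Z(σ+it) ≪ σ/(σ−1/2) + σ √(log(|t|+1)/(σ−1/2))` for `σ > 1/2`." Vendored for `ℛ, 𝒮 ⊂ (0,1) ⊂ ℝ` with all
multiplicities one (then `b_ω := b_{ω,0}` is real and non-zero); the identity `ζ_𝒫 = E e^Z` is recorded on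
`Re s > 1`, where `ζ_𝒫` is the convergent sum `BeurlingPrimes.zeta`. [cite: BrouckeDebruyneRevesz2023, Theorem 3.2] -/
def BrouckeDebruyneRevesz2023_thm32 : Prop :=
  ∀ (R S : Finset ℝ) (δ : ℝ), Disjoint R S → (∀ ρ ∈ R, 0 < ρ ∧ ρ < 1) → (∀ ω ∈ S, 0 < ω ∧ ω < 1) →
    0 < δ → δ < 1 / 2 →
    ∃ P : BeurlingPrimes,
      -- `ψ_𝒫(x) = x + Σ_{ω∈𝒮} x^ω/ω − Σ_{ρ∈ℛ} x^ρ/ρ + O(x^δ)`, `x ≥ 1`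
      (∃ C : ℝ, ∀ x : ℝ, 1 ≤ x →
        |P.chebyshevPsi x - (x + ∑ ω ∈ S, x ^ ω / ω - ∑ ρ ∈ R, x ^ ρ / ρ)| ≤ C * x ^ δ) ∧
      -- `N_𝒫(x) = ax + Σ_{ω∈𝒮, ω>1/2} b_ω x^ω + O(x^{1/2} exp(c (log x)^{2/3}))`, `x ≥ 2`; `a > 0`, `c > 0`, `b_ω ≠ 0`
      (∃ (a c C : ℝ) (b : ℝ → ℝ), 0 < a ∧ 0 < c ∧ (∀ ω ∈ S, 1 / 2 < ω → b ω ≠ 0) ∧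
        ∀ x : ℝ, 2 ≤ x →
          |(P.intCount x : ℝ) - (a * x + ∑ ω ∈ S with 1 / 2 < ω, b ω * x ^ ω)|
            ≤ C * (x ^ (1 / 2 : ℝ) * Real.exp (c * Real.log x ^ (2 / 3 : ℝ)))) ∧
      -- `ζ_𝒫(s) = E_M(s) e^{Z(s)}` (`Re s > 1`), `Z` holomorphic on `Re s > 0`, bound (3.4) on `Re s > 1/2`
      (∃ (M : ℕ) (Z : ℂ → ℂ) (K : ℝ), DifferentiableOn ℂ Z {s : ℂ | 0 < s.re} ∧
        (∀ s : ℂ, 1 / 2 < s.re → ‖Z s‖ ≤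
          K * (s.re / (s.re - 1 / 2) + s.re * Real.sqrt (Real.log (|s.im| + 1) / (s.re - 1 / 2)))) ∧
        (∀ s : ℂ, 1 < s.re → P.zeta s =
          s / (s - 1) * (∏ ω ∈ S, s / (s - ω)) * (∏ ρ ∈ R, (s - ρ) / s) * (s / (s - δ)) ^ M *
            Complex.exp (Z s)))

/-- **Broucke–Debruyne–Révész 2023, Corollary 3.3.** "Let `1/2 ≤ β ≤ α < 1`. Then there exists an
`[α,β]`-Beurling system `(𝒫, 𝒩)`." (From Theorem 3.2 with `ℛ = {α}`, `𝒮 = {β}` if `α > β`, `ℛ = ∅`, `𝒮 = {β}`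
if `α = β`; for `β = 1/2` the pole of `ζ_𝒫` at `s = 1/2` excludes `N_𝒫(x) − ax ≪ x^{1/2−ε}`.)
[cite: BrouckeDebruyneRevesz2023, Corollary 3.3] -/
def BrouckeDebruyneRevesz2023_cor33 : Prop :=
  ∀ α β : ℝ, 1 / 2 ≤ β → β ≤ α → α < 1 → ∃ P : BeurlingPrimes, P.IsSystem α β

/-- **Broucke–Debruyne–Révész 2023, Corollary 3.4.** "Let `0 ≤ α < 1/2`. Then there exists an
`[α, 1/2]`-Beurling system." (From Theorem 3.2 with `ℛ = {α}`, `𝒮 = ∅` if `α > 0`; for `α = 0` the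
`[0,1/2]`-system of Broucke–Vindas; "the fact that `N_𝒫(x) − ax ≪ x^{1/2−ε}` cannot hold for any `ε > 0`
follows from Hilberdink's result `max{α,β} ≥ 1/2`".) [cite: BrouckeDebruyneRevesz2023, Corollary 3.4] -/
def BrouckeDebruyneRevesz2023_cor34 : Prop :=
  ∀ α : ℝ, 0 ≤ α → α < 1 / 2 → ∃ P : BeurlingPrimes, P.IsSystem α (1 / 2)

/-- **Broucke–Debruyne–Révész 2023, §4 (the case `α < β`).** "Assume that `α, β ∈ [0,1)` with `α < β` and
`β > 1/2`. … Let `𝒩` be the sequence of generalized integers generated by `𝒫`. Then `(𝒫, 𝒩)` is an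
`[α,β]`-system." (Template `Π_C(x) = Li(x) − Li(x^α) + Σ_l R_l(x)` whose zeta function has extreme growth to
the left of `Re s = β`, discretised by Theorem 1.2; `ψ_𝒫(x) = x − x^α/α + O(log x)`,
`N_𝒫(x) = ax + O(x^β exp(C√log x) log x)`, and `N_𝒫(x) = ax + O(x^{β−ε})` would make `ζ_𝒫(s) − a/(s−1)`
polynomially bounded on `σ ≥ β − ε/2`, contradicting the extreme growth.) [cite: BrouckeDebruyneRevesz2023, §4] -/
def BrouckeDebruyneRevesz2023_sec4 : Prop :=
  ∀ α β : ℝ, 0 ≤ α → α < β → 1 / 2 < β → β < 1 → ∃ P : BeurlingPrimes, P.IsSystem α β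

/-- **The case split of BDR 2023, Theorem 1.1** ("The two cases `1/2 ≤ β ≤ α` and `α < β` require different
approaches", §1; Figure 1): Corollary 3.3 (`1/2 ≤ β ≤ α < 1`), Corollary 3.4 (`0 ≤ α < 1/2 = β`) and §4
(`α < β`, `β > 1/2`) together give an `[α,β]`-system for every `α ∈ [0,1)`, `β ∈ [1/2,1)`. PROVED (the
assembly step of the printed proof). [cite: BrouckeDebruyneRevesz2023, Theorem 1.1] -/
theorem BrouckeDebruyneRevesz2023_thm11_of_cases (h33 : BrouckeDebruyneRevesz2023_cor33)
    (h34 : BrouckeDebruyneRevesz2023_cor34) (h4 : BrouckeDebruyneRevesz2023_sec4) :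
    BrouckeDebruyneRevesz2023_thm11 := by
  intro α β hα0 hα1 hβ hβ1
  rcases le_or_gt β α with hβα | hαβ
  · -- `1/2 ≤ β ≤ α < 1`: Corollary 3.3
    exact h33 α β hβ hβα hα1
  · rcases hβ.eq_or_lt with hβeq | hβgt
    · -- `α < β = 1/2`: Corollary 3.4
      rw [← hβeq]
      exact h34 α hα0 (lt_of_lt_of_eq hαβ hβeq.symm)
    · -- `α < β`, `β > 1/2`: Section 4
      exact h4 α β hα0 hαβ hβgt hβ1

end Literature.NumberTheory.BeurlingPrimes
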